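import Summits.BirchSwinnertonDyer.BirchSwinnertonDyer.Theorems.ByReductionTypeAtTwoRankOneAtTwoBigImageOddLocalFklClauseA
import HarnessLib

/-!
# Line `fkl` of crux `RankOneAtTwoBigImageOddLocal` (stmt-BirchSwinnertonDyer-23715, route ByReductionTypeAtTwo):
# the TOP LEVEL of a `τ`-prime is REDUNDANT, and level two at `ℓ ≡ 5 (mod 8)` IS the quadratic twist

Lead prover seat `bsd-line-fkl-p1` (g2), helpers `--supports stmt-BirchSwinnertonDyer-23715` (skeleton v7 stubs
`stub_firstLayerHigherCongruence`, `stub_firstLayerNonVanishing` and their analytic twins).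

**Top-level law** (`levelSumTwo_succ_eq_add_sum`).  Let `ℓ` be an odd prime with `2^{j+1} ∥ ℓ − 1`, `ψ : (ℤ/ℓ)ˣ ↠ ℤ/2^{j+1}`
and `ψ' = ψ mod 2^j`.  Then for every cusp form `f`:
`δ'_{j+1}(ℓ; ψ) = δ'_j(ℓ; ψ') + 2^j · ∑_{u ∈ (ℤ/ℓ)ˣ} [u/ℓ]⁺_f`.
Proof: `ψ(−1)` is the element `2^j` of `ℤ/2^{j+1}` (its square is `0` and it is not `0`, because the kernel of `ψ` has odd
order `(ℓ−1)/2^{j+1}`), so the lifts satisfy `ψ̃(−u) = ψ̃(u) ± 2^j`: the top bit `b(u) = ⌊ψ̃(u)/2^j⌋` is flipped by `u ↦ −u`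
while `[−u/ℓ]⁺ = [u/ℓ]⁺`, whence `∑ 2[u/ℓ]⁺ b(u) = ∑ [u/ℓ]⁺`; and `ψ̃ = ψ̃' + 2^j b`.
With the Hecke sum `∑_u [u/ℓ]⁺ = (a_ℓ − 2)[0]⁺` (`heckeSumAtPrimeLevel_holds`) the correction is `2^j (a_ℓ − 2)[0]⁺_f`, which
VANISHES in positive analytic rank (`[0]⁺_f = 0`): **at a `τ`-prime with `2^{j+1} ∥ ℓ − 1` the top-level Kurihara number
equals the level-`j` one** (`levelSumTwo_succ_eq_of_analyticRank_ne_zero`).  In particular for `ℓ ≡ 5 (mod 8)`: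
`δ'_2(ℓ; ψ) = δ'_1(ℓ; ψ') = −T_ℓ(f)` (`levelSumTwo_two_eq_neg_twistSymbolSum`, with g0's prime-level dictionary), where
`T_ℓ(f) = ∑_a (a/ℓ)[a/ℓ]⁺_f = L(E^{(ℓ)},1)/Ω(E^{(ℓ)})` is the quadratic-twist value.
CONSEQUENCES for the v7 stubs (kernel theorems below): at `(k = 2, ℓ ≡ 5 (8))` the higher congruence (HC) reads
«`s ≥ 1 ⇒ 4 ∣ T_ℓ(f)`» (`inTwoPowZLoc_levelSumTwo_two_iff`), and the non-vanishing (NV) for parameter `0` is WITNESSED by any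
`τ`-prime `ℓ ≡ 5 (mod 8)` with `4 ∣ a_ℓ − 2` and `T_ℓ(f) ∉ 4ℤ_{(2)}` — i.e. `L^{alg}(E^{(ℓ)}, 1) = 2 × odd`
(`firstLayerNonVanishing_zero_of_twist`, `stub_firstLayerNonVanishing_of_sha_trivial_of_twist`): for `Ш(E)[2] = 0` slice
curves clause (b) of K2-F is a statement about ONE prime quadratic twist (BSD₂-reading: `Sel₂(E^{(ℓ)}) = 0`, `c_ℓ(E^{(ℓ)}) = 2`).
Also: surjective level characters exist (`exists_surjective_levelChar`) and reduce (`exists_levelChar_reduction`).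
Theorems only; no `def`, no named-fact hypothesis, no `sorry`.  BSD is not proved by any of this.
-/

set_option autoImplicit false

noncomputable section

open scoped Classical MatrixGroups ModularForm

set_option linter.dupNamespace false

namespace Summit.BirchSwinnertonDyer.BirchSwinnertonDyer.Theorems.RankOneAtTwoFkl

open CongruenceSubgroup WeierstrassCurve Literature.NumberTheory.EllipticCurves
  Literature.NumberTheory.EllipticCurves.ModularForms Summit.BirchSwinnertonDyer.Rank1Residual.F1Sign2

/-! ## Level characters: existence, reduction, and the value at `−1` -/

/-- **Level characters exist:** for a prime `ℓ` with `2^k ∣ ℓ − 1` there is a SURJECTIVE homomorphism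
`ψ : (ℤ/ℓ)ˣ → ℤ/2^k` (the unit group is cyclic of order `ℓ − 1`). [folklore] -/
theorem exists_surjective_levelChar {ℓ : ℕ} [Fact ℓ.Prime] {k : ℕ} (h : 2 ^ k ∣ ℓ - 1) :
    ∃ ψ : (ZMod ℓ)ˣ →* Multiplicative (ZMod (2 ^ k)), Function.Surjective ψ := by
  haveI : NeZero (2 ^ k) := ⟨by positivity⟩
  have hcyc : IsCyclic (ZMod ℓ)ˣ := inferInstance
  let e : Multiplicative (ZMod (Nat.card (ZMod ℓ)ˣ)) ≃* (ZMod ℓ)ˣ := zmodCyclicMulEquiv hcyc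
  have hG : Nat.card (ZMod ℓ)ˣ = ℓ - 1 := by rw [Nat.card_eq_fintype_card, ZMod.card_units]
  have hdvd : 2 ^ k ∣ Nat.card (ZMod ℓ)ˣ := hG ▸ h
  let π : ZMod (Nat.card (ZMod ℓ)ˣ) →+* ZMod (2 ^ k) := ZMod.castHom hdvd (ZMod (2 ^ k))
  refine ⟨(AddMonoidHom.toMultiplicative π.toAddMonoidHom).comp e.symm.toMonoidHom, ?_⟩
  intro y
  have hx : π (((Multiplicative.toAdd y).val : ℕ) : ZMod (Nat.card (ZMod ℓ)ˣ)) = Multiplicative.toAdd y := by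
    rw [map_natCast, ZMod.natCast_zmod_val]
  refine ⟨e (Multiplicative.ofAdd (((Multiplicative.toAdd y).val : ℕ) : ZMod (Nat.card (ZMod ℓ)ˣ))), ?_⟩
  simp only [MonoidHom.coe_comp, Function.comp_apply, MulEquiv.coe_toMonoidHom, MulEquiv.symm_apply_apply,
    AddMonoidHom.toMultiplicative_apply_apply, toAdd_ofAdd, RingHom.toAddMonoidHom_eq_coe, AddMonoidHom.coe_coe, hx,
    ofAdd_toAdd]

/-- **Level characters reduce:** a surjective `ψ : G → ℤ/2^{j+1}` composed with reduction mod `2^j` is a surjective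
`ψ' : G → ℤ/2^j` whose canonical lift is `ψ̃'(u) = ψ̃(u) mod 2^j`. [folklore] -/
theorem exists_levelChar_reduction {G : Type*} [Group G] {j : ℕ} (ψ : G →* Multiplicative (ZMod (2 ^ (j + 1))))
    (hψ : Function.Surjective ψ) :
    ∃ ψ' : G →* Multiplicative (ZMod (2 ^ j)), Function.Surjective ψ' ∧
      ∀ u, (Multiplicative.toAdd (ψ' u)).val = (Multiplicative.toAdd (ψ u)).val % 2 ^ j := by
  haveI : NeZero (2 ^ j) := ⟨by positivity⟩
  haveI : NeZero (2 ^ (j + 1)) := ⟨by positivity⟩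
  let π : ZMod (2 ^ (j + 1)) →+* ZMod (2 ^ j) := ZMod.castHom (pow_dvd_pow 2 (Nat.le_succ j)) (ZMod (2 ^ j))
  have hπ : ∀ x : ZMod (2 ^ (j + 1)), (π x).val = x.val % 2 ^ j := by
    intro x
    show (ZMod.castHom (pow_dvd_pow 2 (Nat.le_succ j)) (ZMod (2 ^ j)) x).val = x.val % 2 ^ j
    rw [ZMod.castHom_apply, ZMod.cast_eq_val, ZMod.val_natCast]
  refine ⟨(AddMonoidHom.toMultiplicative π.toAddMonoidHom).comp ψ, ?_, ?_⟩
  · intro y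
    obtain ⟨g, hg⟩ := hψ (Multiplicative.ofAdd (((Multiplicative.toAdd y).val : ℕ) : ZMod (2 ^ (j + 1))))
    refine ⟨g, ?_⟩
    have hx : π (((Multiplicative.toAdd y).val : ℕ) : ZMod (2 ^ (j + 1))) = Multiplicative.toAdd y := by
      rw [map_natCast, ZMod.natCast_zmod_val]
    simp only [MonoidHom.coe_comp, Function.comp_apply, hg, AddMonoidHom.toMultiplicative_apply_apply, toAdd_ofAdd,
      RingHom.toAddMonoidHom_eq_coe, AddMonoidHom.coe_coe, hx, ofAdd_toAdd]
  · intro u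
    simp only [MonoidHom.coe_comp, Function.comp_apply, AddMonoidHom.toMultiplicative_apply_apply, toAdd_ofAdd,
      RingHom.toAddMonoidHom_eq_coe, AddMonoidHom.coe_coe]
    exact hπ _

/-- A prime `ℓ` with `2^{j+1} ∣ ℓ − 1` is at least `3`. [folklore] -/
theorem two_lt_of_pow_succ_dvd_sub_one {ℓ : ℕ} [Fact ℓ.Prime] {j : ℕ} (h1 : 2 ^ (j + 1) ∣ ℓ - 1) : 2 < ℓ := by
  have hℓ : ℓ.Prime := Fact.out
  have h2 : 2 ≤ 2 ^ (j + 1) := by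
    calc (2 : ℕ) = 2 ^ 1 := by norm_num
      _ ≤ 2 ^ (j + 1) := Nat.pow_le_pow_right (by norm_num) (by omega)
  have hle := hℓ.two_le
  rcases Nat.eq_zero_or_pos (ℓ - 1) with h0 | hpos
  · omega
  · have := Nat.le_of_dvd hpos h1
    omega

/-- **`ψ(−1)` is the element of order two `2^j ∈ ℤ/2^{j+1}`** for a surjective `ψ : (ℤ/ℓ)ˣ → ℤ/2^{j+1}` at a prime with
`2^{j+1} ∥ ℓ − 1`: `ψ(−1)² = ψ(1) = 0` and `ψ(−1) ≠ 0` because `ker ψ` has ODD order `(ℓ − 1)/2^{j+1}` while `−1` has order `2`.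
[folklore] -/
theorem val_toAdd_apply_neg_one {ℓ : ℕ} [Fact ℓ.Prime] {j : ℕ} (h1 : 2 ^ (j + 1) ∣ ℓ - 1)
    (h2 : ¬ 2 ^ (j + 2) ∣ ℓ - 1) (ψ : (ZMod ℓ)ˣ →* Multiplicative (ZMod (2 ^ (j + 1))))
    (hψ : Function.Surjective ψ) : (Multiplicative.toAdd (ψ (-1))).val = 2 ^ j := by
  haveI : NeZero (2 ^ (j + 1)) := ⟨by positivity⟩
  haveI : Fact (2 < ℓ) := ⟨two_lt_of_pow_succ_dvd_sub_one h1⟩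
  set A := Multiplicative.toAdd (ψ (-1)) with hA
  have hAA : A + A = 0 := by
    have h : ψ (-1) * ψ (-1) = 1 := by rw [← map_mul, neg_mul_neg, one_mul, map_one]
    have := congrArg Multiplicative.toAdd h
    rwa [toAdd_mul, toAdd_one] at this
  have hA0 : A ≠ 0 := by
    intro hA0
    have hker : (-1 : (ZMod ℓ)ˣ) ∈ ψ.ker := by
      rw [MonoidHom.mem_ker]
      have : Multiplicative.ofAdd (Multiplicative.toAdd (ψ (-1))) = Multiplicative.ofAdd (0 : ZMod (2 ^ (j + 1))) := by
        rw [← hA, hA0]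
      simpa using this
    have hcard : Nat.card (ZMod ℓ)ˣ = Nat.card ((ZMod ℓ)ˣ ⧸ ψ.ker) * Nat.card ψ.ker :=
      Subgroup.card_eq_card_quotient_mul_card_subgroup _
    have hq : Nat.card ((ZMod ℓ)ˣ ⧸ ψ.ker) = 2 ^ (j + 1) := by
      rw [Nat.card_congr (QuotientGroup.quotientKerEquivOfSurjective ψ hψ).toEquiv, Nat.card_eq_fintype_card,
        Fintype.card_multiplicative, ZMod.card]
    have hG : Nat.card (ZMod ℓ)ˣ = ℓ - 1 := by rw [Nat.card_eq_fintype_card, ZMod.card_units]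
    have ho : orderOf (-1 : (ZMod ℓ)ˣ) = 2 := by
      refine orderOf_eq_prime ?_ ?_
      · rw [neg_one_sq]
      · intro h
        have h' := congrArg (fun x : (ZMod ℓ)ˣ => (x : ZMod ℓ)) h
        simp only [Units.val_neg, Units.val_one] at h'
        exact ZMod.neg_one_ne_one h'
    have h2dvd : 2 ∣ Nat.card ψ.ker := by
      have ho' : orderOf (⟨-1, hker⟩ : ψ.ker) = 2 := by
        rw [← Subgroup.orderOf_coe]; exact ho
      have hd := orderOf_dvd_natCard (⟨-1, hker⟩ : ψ.ker)
      rwa [ho'] at hd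
    obtain ⟨c, hc⟩ := h2dvd
    apply h2
    refine ⟨c, ?_⟩
    rw [← hG, hcard, hq, hc]
    ring
  have hval2 : (A + A).val = 0 := by rw [hAA, ZMod.val_zero]
  rw [ZMod.val_add] at hval2
  have hdvd : 2 ^ (j + 1) ∣ 2 * A.val := by rw [two_mul]; exact Nat.dvd_of_mod_eq_zero hval2
  have hdvd' : 2 ^ j ∣ A.val := by
    obtain ⟨d, hd⟩ := hdvd
    refine ⟨d, ?_⟩
    have h' : 2 * A.val = 2 * (2 ^ j * d) := by rw [hd]; ring
    exact Nat.eq_of_mul_eq_mul_left two_pos h'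
  obtain ⟨c, hc⟩ := hdvd'
  have hlt : A.val < 2 ^ (j + 1) := ZMod.val_lt A
  have hne : A.val ≠ 0 := fun h => hA0 ((ZMod.val_eq_zero A).mp h)
  have hP : 0 < 2 ^ j := by positivity
  have hc2 : c < 2 := by
    by_contra hc2
    push Not at hc2
    have : 2 ^ (j + 1) ≤ A.val := by
      rw [hc, pow_succ]
      exact Nat.mul_le_mul_left _ hc2
    omega
  have hc0 : c ≠ 0 := by
    rintro rfl
    rw [mul_zero] at hc
    exact hne hc
  have hc1 : c = 1 := by omega
  rw [hc, hc1, mul_one]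

/-! ## The top-level law -/

/-- **TOP-LEVEL LAW for Kurihara numbers at two.**  For a cusp form `f`, an odd prime `ℓ` with `2^{j+1} ∥ ℓ − 1`, a
surjective `ψ : (ℤ/ℓ)ˣ → ℤ/2^{j+1}` and its reduction `ψ' = ψ mod 2^j` (any `ψ'` with `ψ̃' = ψ̃ mod 2^j`):
`δ'_{j+1}(ℓ; ψ) = δ'_j(ℓ; ψ') + 2^j · ∑_{u ∈ (ℤ/ℓ)ˣ} [u/ℓ]⁺_f`.  See the file header for the proof (top bit of `ψ̃` is
flipped by `u ↦ −u`, plus symbols are even). [folklore] -/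
theorem levelSumTwo_succ_eq_add_sum {M : ℕ} [NeZero M] (f : CuspForm (Gamma0 M) 2)
    {ℓ : ℕ} [Fact ℓ.Prime] {j : ℕ} (h1 : 2 ^ (j + 1) ∣ ℓ - 1) (h2 : ¬ 2 ^ (j + 2) ∣ ℓ - 1)
    (ψ : (ZMod ℓ)ˣ →* Multiplicative (ZMod (2 ^ (j + 1)))) (hψ : Function.Surjective ψ)
    (ψ' : (ZMod ℓ)ˣ →* Multiplicative (ZMod (2 ^ j)))
    (hψ' : ∀ u, (Multiplicative.toAdd (ψ' u)).val = (Multiplicative.toAdd (ψ u)).val % 2 ^ j) :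
    levelSumTwo f ℓ (j + 1) ψ =
      levelSumTwo f ℓ j ψ' + 2 ^ j * ∑ u : (ZMod ℓ)ˣ, ratPlusSymbol f ((((u : ZMod ℓ).val : ℚ)) / ℓ) := by
  have hℓ : ℓ.Prime := Fact.out
  haveI : NeZero ℓ := ⟨hℓ.ne_zero⟩
  haveI : NeZero (2 ^ (j + 1)) := ⟨by positivity⟩
  have hP0 : 0 < 2 ^ j := by positivity
  have h2P : 2 ^ (j + 1) = 2 * 2 ^ j := by rw [pow_succ, mul_comm]
  set a : (ZMod ℓ)ˣ → ℕ := fun u => (Multiplicative.toAdd (ψ u)).val with ha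
  set g : (ZMod ℓ)ˣ → ℚ := fun u => ratPlusSymbol f ((((u : ZMod ℓ).val : ℚ)) / ℓ) with hg
  have ha_lt : ∀ u, a u < 2 * 2 ^ j := fun u => h2P ▸ ZMod.val_lt _
  have hAval : (Multiplicative.toAdd (ψ (-1))).val = 2 ^ j := val_toAdd_apply_neg_one h1 h2 ψ hψ
  have ha_neg : ∀ u, a (-u) = (a u + 2 ^ j) % (2 * 2 ^ j) := by
    intro u
    have hmul : ψ (-u) = ψ (-1) * ψ u := by rw [← map_mul, neg_one_mul]
    show (Multiplicative.toAdd (ψ (-u))).val = ((Multiplicative.toAdd (ψ u)).val + 2 ^ j) % (2 * 2 ^ j)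
    rw [hmul, toAdd_mul, ZMod.val_add, hAval, ← h2P, Nat.add_comm]
  have hg_neg : ∀ u, g (-u) = g u := fun u => ratPlusSymbol_neg_unit f u
  -- the top bit is flipped by `u ↦ -u`
  have hb_neg : ∀ u, a (-u) / 2 ^ j + a u / 2 ^ j = 1 := by
    intro u
    rw [ha_neg u]
    have hlt := ha_lt u
    rcases Nat.lt_or_ge (a u) (2 ^ j) with h | h
    · have e0 : (a u + 2 ^ j) % (2 * 2 ^ j) = a u + 2 ^ j := Nat.mod_eq_of_lt (by omega)
      have e1 : (a u + 2 ^ j) / 2 ^ j = 1 := by rw [Nat.add_div_right _ hP0, Nat.div_eq_of_lt h]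
      have e2 : a u / 2 ^ j = 0 := Nat.div_eq_of_lt h
      rw [e0, e1, e2]
    · have e0 : (a u + 2 ^ j) % (2 * 2 ^ j) = a u - 2 ^ j := by
        rw [Nat.mod_eq_sub_mod (by omega : 2 * 2 ^ j ≤ a u + 2 ^ j)]
        rw [show a u + 2 ^ j - 2 * 2 ^ j = a u - 2 ^ j by omega]
        exact Nat.mod_eq_of_lt (by omega)
      have e1 : (a u - 2 ^ j) / 2 ^ j = 0 := Nat.div_eq_of_lt (by omega)
      have e2 : a u / 2 ^ j = 1 := Nat.div_eq_of_lt_le (by omega) (by omega)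
      rw [e0, e1, e2]
  -- Step 1: split `ψ̃ = (ψ̃ mod 2^j) + 2^j ⌊ψ̃/2^j⌋` inside `δ'_{j+1}`
  have step1 : levelSumTwo f ℓ (j + 1) ψ =
      (∑ u : (ZMod ℓ)ˣ, 2 * g u * ((a u % 2 ^ j : ℕ) : ℚ)) +
        2 * ((2 ^ j : ℕ) : ℚ) * ∑ u : (ZMod ℓ)ˣ, g u * ((a u / 2 ^ j : ℕ) : ℚ) := by
    unfold levelSumTwo
    rw [Finset.mul_sum, ← Finset.sum_add_distrib]
    refine Finset.sum_congr rfl fun u _ => ?_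
    have hd : ((a u : ℕ) : ℚ) = ((a u % 2 ^ j : ℕ) : ℚ) + ((2 ^ j : ℕ) : ℚ) * ((a u / 2 ^ j : ℕ) : ℚ) := by
      exact_mod_cast (Nat.mod_add_div (a u) (2 ^ j)).symm
    show 2 * g u * ((a u : ℕ) : ℚ) =
      2 * g u * ((a u % 2 ^ j : ℕ) : ℚ) + 2 * ((2 ^ j : ℕ) : ℚ) * (g u * ((a u / 2 ^ j : ℕ) : ℚ))
    rw [hd]
    ring
  -- Step 2: the first sum is `δ'_j(ψ')`
  have step2 : levelSumTwo f ℓ j ψ' = ∑ u : (ZMod ℓ)ˣ, 2 * g u * ((a u % 2 ^ j : ℕ) : ℚ) := by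
    unfold levelSumTwo
    refine Finset.sum_congr rfl fun u _ => ?_
    show 2 * g u * (((Multiplicative.toAdd (ψ' u)).val : ℕ) : ℚ) = 2 * g u * ((a u % 2 ^ j : ℕ) : ℚ)
    rw [hψ' u]
  -- Step 3: the top-bit sum is half the full symbol sum
  have step3 : 2 * ∑ u : (ZMod ℓ)ˣ, g u * ((a u / 2 ^ j : ℕ) : ℚ) = ∑ u : (ZMod ℓ)ˣ, g u := by
    have hre : ∑ u : (ZMod ℓ)ˣ, g u * ((a u / 2 ^ j : ℕ) : ℚ) =
        ∑ u : (ZMod ℓ)ˣ, g u * (1 - ((a u / 2 ^ j : ℕ) : ℚ)) := by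
      refine Fintype.sum_equiv (Equiv.neg (ZMod ℓ)ˣ) _ _ fun u => ?_
      simp only [Equiv.neg_apply]
      rw [hg_neg u]
      congr 1
      have h := congrArg (Nat.cast (R := ℚ)) (hb_neg u)
      push_cast at h
      linarith
    have hsum : (∑ u : (ZMod ℓ)ˣ, g u * ((a u / 2 ^ j : ℕ) : ℚ)) +
        ∑ u : (ZMod ℓ)ˣ, g u * (1 - ((a u / 2 ^ j : ℕ) : ℚ)) = ∑ u : (ZMod ℓ)ˣ, g u := by
      rw [← Finset.sum_add_distrib]
      refine Finset.sum_congr rfl fun u _ => ?_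
      ring
    linarith
  have hPq : ((2 ^ j : ℕ) : ℚ) = 2 ^ j := by push_cast; ring
  rw [step1, ← step2, hPq]
  linear_combination (2 ^ j : ℚ) * step3

/-- **Top-level law, Hecke form:** for the newform `f` of a globally minimal `W/ℚ` and a prime `ℓ ∤ N_W` with
`2^{j+1} ∥ ℓ − 1`: `δ'_{j+1}(ℓ; ψ) = δ'_j(ℓ; ψ') + 2^j (a_ℓ(W) − 2)[0]⁺_f`. [folklore] -/
theorem levelSumTwo_succ_eq_add_hecke (W : WeierstrassCurve ℚ) [W.IsElliptic] [W.IsGloballyMinimal]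
    {M : ℕ} [NeZero M] (f : CuspForm (Gamma0 M) 2) (hf : IsNewformOf W f)
    {ℓ : ℕ} [Fact ℓ.Prime] (hN : Nat.Coprime (W.conductorNorm ℤ) ℓ) {j : ℕ} (h1 : 2 ^ (j + 1) ∣ ℓ - 1)
    (h2 : ¬ 2 ^ (j + 2) ∣ ℓ - 1)
    (ψ : (ZMod ℓ)ˣ →* Multiplicative (ZMod (2 ^ (j + 1)))) (hψ : Function.Surjective ψ)
    (ψ' : (ZMod ℓ)ˣ →* Multiplicative (ZMod (2 ^ j)))
    (hψ' : ∀ u, (Multiplicative.toAdd (ψ' u)).val = (Multiplicative.toAdd (ψ u)).val % 2 ^ j) :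
    levelSumTwo f ℓ (j + 1) ψ =
      levelSumTwo f ℓ j ψ' + 2 ^ j * (((W.frobeniusTrace ℓ : ℚ) - 2) * ratPlusSymbol f 0) := by
  rw [levelSumTwo_succ_eq_add_sum f h1 h2 ψ hψ ψ' hψ', heckeSumAtPrimeLevel_holds W f hf ℓ hN]

/-- **Top-level redundancy in positive analytic rank:** `[0]⁺_f = 0`, so at a prime `ℓ ∤ N_W` with `2^{j+1} ∥ ℓ − 1` the
level-`(j+1)` Kurihara number EQUALS the level-`j` one of the reduced character: `δ'_{j+1}(ℓ; ψ) = δ'_j(ℓ; ψ mod 2^j)`.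
[folklore] -/
theorem levelSumTwo_succ_eq_of_analyticRank_ne_zero (W : WeierstrassCurve ℚ) [W.IsElliptic] [W.IsGloballyMinimal]
    {M : ℕ} [NeZero M] (f : CuspForm (Gamma0 M) 2) (hf : IsNewformOf W f) (hr : W.analyticRank ≠ 0)
    {ℓ : ℕ} [Fact ℓ.Prime] (hN : Nat.Coprime (W.conductorNorm ℤ) ℓ) {j : ℕ} (h1 : 2 ^ (j + 1) ∣ ℓ - 1)
    (h2 : ¬ 2 ^ (j + 2) ∣ ℓ - 1)
    (ψ : (ZMod ℓ)ˣ →* Multiplicative (ZMod (2 ^ (j + 1)))) (hψ : Function.Surjective ψ)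
    (ψ' : (ZMod ℓ)ˣ →* Multiplicative (ZMod (2 ^ j)))
    (hψ' : ∀ u, (Multiplicative.toAdd (ψ' u)).val = (Multiplicative.toAdd (ψ u)).val % 2 ^ j) :
    levelSumTwo f ℓ (j + 1) ψ = levelSumTwo f ℓ j ψ' := by
  rw [levelSumTwo_succ_eq_add_hecke W f hf hN h1 h2 ψ hψ ψ' hψ',
    ratPlusSymbol_zero_eq_zero_of_analyticRank_ne_zero W f hf hr, mul_zero, mul_zero, add_zero]

/-! ## Level two at `ℓ ≡ 5 (mod 8)` is the quadratic twist -/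

/-- `ℓ ≡ 5 (mod 8)` means `4 ∥ ℓ − 1`. [folklore] -/
theorem four_dvd_and_not_eight_dvd_of_mod_eight_eq_five {ℓ : ℕ} (h8 : ℓ % 8 = 5) :
    2 ^ (1 + 1) ∣ ℓ - 1 ∧ ¬ 2 ^ (1 + 2) ∣ ℓ - 1 := by
  norm_num
  omega

/-- **Level two at `ℓ ≡ 5 (mod 8)` IS the quadratic twist.**  For the newform `f` of a globally minimal `W/ℚ` of positive
analytic rank, an odd prime `ℓ ∤ N_W` with `ℓ ≡ 5 (mod 8)` and ANY surjective `ψ : (ℤ/ℓ)ˣ → ℤ/4`: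
`δ'_2(ℓ; ψ) = −T_ℓ(f)` (`T_ℓ(f) = ∑_a (a/ℓ)[a/ℓ]⁺_f`, the quadratic-twist symbol sum `F1Sign2.twistSymbolSum`).
Top-level law + g0's prime-level dictionary `levelSumTwo_one_eq_neg_twistSymbolSum`. [folklore] -/
theorem levelSumTwo_two_eq_neg_twistSymbolSum (W : WeierstrassCurve ℚ) [W.IsElliptic] [W.IsGloballyMinimal]
    {M : ℕ} [NeZero M] (f : CuspForm (Gamma0 M) 2) (hf : IsNewformOf W f) (hr : W.analyticRank ≠ 0)
    {ℓ : ℕ} [Fact ℓ.Prime] (hN : ¬ ℓ ∣ W.conductorNorm ℤ) (h8 : ℓ % 8 = 5)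
    (ψ : (ZMod ℓ)ˣ →* Multiplicative (ZMod (2 ^ 2))) (hψ : Function.Surjective ψ) :
    levelSumTwo f ℓ 2 ψ = - twistSymbolSum f ℓ := by
  have hℓ : ℓ.Prime := Fact.out
  have hℓ2 : ℓ ≠ 2 := by rintro rfl; norm_num at h8
  have hcop : Nat.Coprime (W.conductorNorm ℤ) ℓ := ((Nat.Prime.coprime_iff_not_dvd hℓ).mpr hN).symm
  obtain ⟨h1, h2⟩ := four_dvd_and_not_eight_dvd_of_mod_eight_eq_five h8
  obtain ⟨ψ', hψ's, hψ'⟩ := exists_levelChar_reduction (j := 1) ψ hψ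
  have key := levelSumTwo_succ_eq_of_analyticRank_ne_zero W f hf hr hcop (j := 1) h1 h2 ψ hψ ψ' hψ'
  show levelSumTwo f ℓ (1 + 1) ψ = _
  rw [key, levelSumTwo_one_eq_neg_twistSymbolSum W f hf hr hℓ2 hN ψ' hψ's]

/-- **(HC) at `(k = 2, ℓ ≡ 5 (8))` reads on the quadratic twist:** in positive analytic rank,
`δ'_2(ℓ; ψ) ∈ 2^m ℤ_{(2)} ⟺ T_ℓ(f) ∈ 2^m ℤ_{(2)}` — so the v7 stub `stub_firstLayerHigherCongruence` at such rows says
«`s ≥ 1 ⇒ 4 ∣ T_ℓ(f) = L^{alg}(E^{(ℓ)},1)`». [folklore] -/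
theorem inTwoPowZLoc_levelSumTwo_two_iff (W : WeierstrassCurve ℚ) [W.IsElliptic] [W.IsGloballyMinimal]
    {M : ℕ} [NeZero M] (f : CuspForm (Gamma0 M) 2) (hf : IsNewformOf W f) (hr : W.analyticRank ≠ 0)
    {ℓ : ℕ} [Fact ℓ.Prime] (hN : ¬ ℓ ∣ W.conductorNorm ℤ) (h8 : ℓ % 8 = 5)
    (ψ : (ZMod ℓ)ˣ →* Multiplicative (ZMod (2 ^ 2))) (hψ : Function.Surjective ψ) (m : ℕ) :
    InTwoPowZLoc m (levelSumTwo f ℓ 2 ψ) ↔ InTwoPowZLoc m (twistSymbolSum f ℓ) := by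
  rw [levelSumTwo_two_eq_neg_twistSymbolSum W f hf hr hN h8 ψ hψ, inTwoPowZLoc_neg_iff]

/-- **(NV) for parameter `0` from ONE prime quadratic twist.**  For the newform `f` of a globally minimal `W/ℚ` of
positive analytic rank: a `τ`-prime `ℓ ≡ 5 (mod 8)` (`IsLevelAtTwo W ℓ`) with `4 ∣ a_ℓ(W) − 2` and `T_ℓ(f) ∉ 4ℤ_{(2)}`
(«`L^{alg}(E^{(ℓ)},1) = 2 × odd`») is a row `(ℓ, 2, ψ)` of the first Kolyvagin layer with `δ'_2(ℓ; ψ) ∉ 2^{0+2} ℤ_{(2)}` — the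
non-vanishing clause (b) of K2-F / K2-F_an with parameter `0`. [folklore] -/
theorem firstLayerNonVanishing_zero_of_twist (W : WeierstrassCurve ℚ) [W.IsElliptic] [W.IsGloballyMinimal]
    {M : ℕ} [NeZero M] (f : CuspForm (Gamma0 M) 2) (hf : IsNewformOf W f) (hr : W.analyticRank ≠ 0)
    (ℓ : ℕ) [Fact ℓ.Prime] (hlev : IsLevelAtTwo W ℓ) (h8 : ℓ % 8 = 5)
    (ha : (2 ^ 2 : ℤ) ∣ W.frobeniusTrace ℓ - 2) (hT : ¬ InTwoPowZLoc 2 (twistSymbolSum f ℓ)) :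
    ∃ (ℓ k : ℕ) (_ : Fact ℓ.Prime) (ψ : (ZMod ℓ)ˣ →* Multiplicative (ZMod (2 ^ k))),
      IsLevelAtTwo W ℓ ∧ 0 + 2 ≤ k ∧ (2 ^ k : ℤ) ∣ (ℓ : ℤ) - 1 ∧ (2 ^ k : ℤ) ∣ W.frobeniusTrace ℓ - 2 ∧
      Function.Surjective ψ ∧ ¬ InTwoPowZLoc (0 + 2) (levelSumTwo f ℓ k ψ) := by
  have hℓ : ℓ.Prime := Fact.out
  obtain ⟨-, hN⟩ := ne_two_and_not_dvd_of_isLevelAtTwo W hlev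
  have h4 : 2 ^ 2 ∣ ℓ - 1 := by norm_num; omega
  obtain ⟨ψ, hψ⟩ := exists_surjective_levelChar (ℓ := ℓ) h4
  refine ⟨ℓ, 2, ‹Fact ℓ.Prime›, ψ, hlev, le_rfl, ?_, ha, hψ, ?_⟩
  · have h1 : 1 ≤ ℓ := hℓ.one_lt.le
    have : ((2 ^ 2 : ℕ) : ℤ) ∣ ((ℓ - 1 : ℕ) : ℤ) := Int.natCast_dvd_natCast.mpr h4
    push_cast [Nat.cast_sub h1] at this
    exact this
  · rw [zero_add, inTwoPowZLoc_levelSumTwo_two_iff W f hf hr hN h8 ψ hψ 2]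
    exact hT

/-- **Clause (b) of K2-F for `Ш(E)[2^∞] = 0` curves from one prime quadratic twist** — under the binders of the v7 stub
`stub_firstLayerNonVanishing` (= clause (b) of `F1Sign2.FirstLayerLawAtTwo`): if `#Ш(E)[2^∞] = 1` (parameter `s = 0`) and some
`τ`-prime `ℓ ≡ 5 (mod 8)` with `4 ∣ a_ℓ − 2` has `T_ℓ(f) ∉ 4ℤ_{(2)}`, the stub's conclusion holds at `W`.  (`w = −1` gives
`r_an ≥ 1` by the tree's `analyticRank_pos_of_rootNumber_eq_neg_one`; the other binders are idle.)  BSD₂-reading of the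
witness (not used): `Sel₂(E^{(ℓ)}) = 0` at a Kummer `τ`-prime (Mazur–Rubin 2010 Prop. 3.3 with `T = {ℓ}`) and `c_ℓ(E^{(ℓ)}) = 2`.
[conjecture] instance, kernel theorem. -/
theorem stub_firstLayerNonVanishing_of_sha_trivial_of_twist
    (W : WeierstrassCurve ℚ) [W.IsElliptic] [W.IsGloballyMinimal] {M : ℕ} [NeZero M]
    (f : CuspForm (Gamma0 M) 2) (hf : IsNewformOf W f) (_hper : PeriodTransferAtTwo W f)
    (_hsurj : ∀ n : ℕ, W.HasSurjectiveModNGaloisRep ((2 ^ n : ℕ) : ℤ)) (_hT : Odd W.torsionOrder)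
    (_hc : Odd W.tamagawaProduct) (hw : W.rootNumber = -1) (_hr : W.mordellWeilRank = 1)
    (_hfin : Finite (AddCommGroup.primaryComponent W.sha 2))
    (hsha : Nat.card (AddCommGroup.primaryComponent W.sha 2) = 1)
    (htw : ∃ (ℓ : ℕ) (_ : Fact ℓ.Prime), IsLevelAtTwo W ℓ ∧ ℓ % 8 = 5 ∧ (2 ^ 2 : ℤ) ∣ W.frobeniusTrace ℓ - 2 ∧
      ¬ InTwoPowZLoc 2 (twistSymbolSum f ℓ)) :
    let s := padicValNat 2 (Nat.card (AddCommGroup.primaryComponent W.sha 2))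
    ∃ (ℓ k : ℕ) (_ : Fact ℓ.Prime) (ψ : (ZMod ℓ)ˣ →* Multiplicative (ZMod (2 ^ k))),
      IsLevelAtTwo W ℓ ∧ s + 2 ≤ k ∧ (2 ^ k : ℤ) ∣ (ℓ : ℤ) - 1 ∧ (2 ^ k : ℤ) ∣ W.frobeniusTrace ℓ - 2 ∧
      Function.Surjective ψ ∧ ¬ InTwoPowZLoc (s + 2) (levelSumTwo f ℓ k ψ) := by
  simp only [hsha, padicValNat_one_right]
  obtain ⟨ℓ, hℓ, hlev, h8, ha, hT⟩ := htw
  exact firstLayerNonVanishing_zero_of_twist W f hf (W.analyticRank_pos_of_rootNumber_eq_neg_one hw).ne' ℓ hlev h8 ha hT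

/-- **Clause (b) of K2-F_an for `ord₂ Ш_an ≤ 0` from one prime quadratic twist** — the analytic twin under the binders of
`stub_analyticFirstLayerNonVanishing` (`s_an = (ord₂ q).toNat = 0`). [conjecture] instance, kernel theorem. -/
theorem stub_analyticFirstLayerNonVanishing_of_padicValRat_le_of_twist
    (W : WeierstrassCurve ℚ) [W.IsElliptic] [W.IsGloballyMinimal] {M : ℕ} [NeZero M]
    (f : CuspForm (Gamma0 M) 2) (hf : IsNewformOf W f) (_hper : PeriodTransferAtTwo W f)
    (_hsurj : ∀ n : ℕ, W.HasSurjectiveModNGaloisRep ((2 ^ n : ℕ) : ℤ)) (_hT : Odd W.torsionOrder)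
    (_hc : Odd W.tamagawaProduct) (_hw : W.rootNumber = -1) (han : W.analyticRank = 1)
    (q : ℚ) (_hq : shaAn W = (q : ℂ)) (_hq0 : q ≠ 0) (hv : padicValRat 2 q ≤ 0)
    (htw : ∃ (ℓ : ℕ) (_ : Fact ℓ.Prime), IsLevelAtTwo W ℓ ∧ ℓ % 8 = 5 ∧ (2 ^ 2 : ℤ) ∣ W.frobeniusTrace ℓ - 2 ∧
      ¬ InTwoPowZLoc 2 (twistSymbolSum f ℓ)) :
    let s := (padicValRat 2 q).toNat
    ∃ (ℓ k : ℕ) (_ : Fact ℓ.Prime) (ψ : (ZMod ℓ)ˣ →* Multiplicative (ZMod (2 ^ k))),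
      IsLevelAtTwo W ℓ ∧ s + 2 ≤ k ∧ (2 ^ k : ℤ) ∣ (ℓ : ℤ) - 1 ∧ (2 ^ k : ℤ) ∣ W.frobeniusTrace ℓ - 2 ∧
      Function.Surjective ψ ∧ ¬ InTwoPowZLoc (s + 2) (levelSumTwo f ℓ k ψ) := by
  have hs : (padicValRat 2 q).toNat = 0 := Int.toNat_of_nonpos hv
  simp only [hs]
  obtain ⟨ℓ, hℓ, hlev, h8, ha, hT⟩ := htw
  exact firstLayerNonVanishing_zero_of_twist W f hf (by rw [han]; exact one_ne_zero) ℓ hlev h8 ha hT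

end Summit.BirchSwinnertonDyer.BirchSwinnertonDyer.Theorems.RankOneAtTwoFkl

end
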